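import Literature.AnabelianGeometry.SemiGraphs.ArithTemperedGroupLevelTopology
import Literature.AnabelianGeometry.SemiGraphs.OuterSemidirectProductTopology
import HarnessLib

/-!
# [SemiAnbd] §0 p. 5 / Prop 5.2 (iv): the TEMPERED level topology of `π₁^temp(𝒢) ⋊^out Π_A` versus the
# generic outer-semidirect-product topology along the same levels — comparison

Mochizuki, *Semi-graphs of anabelioids*, Publ. RIMS **42** (2006), §0 p. 5 (`G ⋊^out J`, "a natural exact
sequence `1 → G → G ⋊^out J → J → 1`" of topological groups), Prop 5.2 (iv) p. 64
[cite: MochizukiSemiAnbd2006, Prop 5.2 (iv), p. 64].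

PROOF-ONLY (no definition, no named fact).  abc-iut cell, producer row T54-B (`HOME/plan/GAP-LEDGER.md`
G-w4d053-1), sub-rows «T54·E-top» (abc-iut-w6-d070: `ProfiniteSemiGraph.arithLevelTopology`, the tempered
topology of abc-iut-L3-d2 with basis `levelKer (N n) ⊓ aug⁻¹U`) and «G-P13-GR» (abc-iut-w5-d151:
`outerSemidirectProduct.topology ρ N hdir hinv`, the generic group topology with basis
`levelNhd (N n) V = {e | Φₑ ≡ id mod N n, aug e ∈ V}`), L3-lead ruling α49 («comparison lemma»).  For the
SAME outer action `ρ : Π_A → Out(π₁^temp 𝒢)` and the SAME antitone family of `Φ`-stable levels `N n`: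

* `arithLevelTopology_le_topology` — the tempered level topology is FINER (`≤` in Mathlib's order on
  `TopologicalSpace`): every identity neighbourhood `levelNhd (N n) V` contains the basic tempered
  neighbourhood `levelKer (N n) ⊓ aug⁻¹U` for an open normal `U ⊆ V` of the tempered `Π_A`
  (`levelKer ⊆ centralMod`, and "`Φₑ(y) y⁻¹ ∈ N`" ⟺ "`y⁻¹ Φₑ(y) ∈ N`" for normal `N`);
* `topology_le_arithLevelTopology_of_isOpen` — conversely the generic topology is finer than (hence, with
  the above, EQUAL to: `arithLevelTopology_eq_topology_of_isOpen`) the tempered one as soon as the two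
  extra ingredients of `levelKer` are open for it: the kernels of the arithmetic actions on the level
  coset semi-graphs (`hKopen` in the generic topology) and the kernel of the action on the underlying
  semi-graph (`IsOpen (ker baseAct)`, [SemiAnbd] Def 5.1 (i)(c)).

So the two rows define ONE topology exactly when `hKopen` holds for the generic one; unconditionally the
T54 capstone's `hKopen` is available for `arithLevelTopology` (`ProfiniteSemiGraph.isOpen_ker_arithAct`).
Nothing here refers to the IUT corpus beyond the producer row; no side is taken on [IUTchIII] Cor 3.12;
typed ≠ proved for the residual binders.
-/

namespace Literature.AnabelianGeometry.SemiGraphs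

namespace ProfiniteSemiGraph

open CategoryTheory Topology Filter
open Literature.AnabelianGeometry.EtaleTheta

universe u

variable {𝒢 : ProfiniteSemiGraph.{u}} (c : TemperedPiChart 𝒢)
  {PA : Type u} [Group PA] [TopologicalSpace PA] [IsTopologicalGroup PA]
  (ρ : PA →* TopOut c.G) (baseAct : PA →* Aut 𝒢.graph)

section Helpers

omit [TopologicalSpace PA] [IsTopologicalGroup PA] in
/-- The `Φ`-stability of the levels in the currency of abc-iut-w5-d151's generic layer (`hinv`): the first
component of `e ∈ π₁^temp(𝒢) ⋊^out Π_A` IS `Φ e`. [cite: MochizukiSemiAnbd2006, §0 p.5] -/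
theorem hinv_of_hNst (N : ℕ → Subgroup c.G)
    (hNst : ∀ (n : ℕ) (e : outerSemidirectProduct ρ) (x : c.G), x ∈ N n →
      (((contMulAut c.G).subtype.comp (MonoidHom.fst (contMulAut c.G) PA)).comp
        (outerSemidirectProduct ρ).subtype) e x ∈ N n) :
    ∀ (n : ℕ) (e : outerSemidirectProduct ρ) (g : c.G), g ∈ N n → (e.1.1 : MulAut c.G) g ∈ N n :=
  fun n e g hg => hNst n e g hg

/-- An antitone `ℕ`-family of levels is directed downwards (`hdir` of the generic layer).
[cite: MochizukiSemiAnbd2006, §0 p.5] -/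
theorem directed_ge_of_antitone (N : ℕ → Subgroup c.G) (hNanti : Antitone N) : Directed (· ≥ ·) N :=
  fun m n => ⟨max m n, hNanti (le_max_left m n), hNanti (le_max_right m n)⟩

end Helpers

section Comparison

variable [FirstCountableTopology c.G]
  (h36 : 𝒢.Prop36Hypotheses) (hA : IsTempered PA)
  (P : SemiGraph.SubgroupPresentation 𝒢.graph c.G)
  (hP : P.IsArithCompatible
    (((contMulAut c.G).subtype.comp (MonoidHom.fst (contMulAut c.G) PA)).comp
      (outerSemidirectProduct ρ).subtype)
    (baseAct.comp (outerSemidirectProductSnd ρ)))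
  (w₀ : 𝒢.graph.Vertex) (hcpt : IsCompact (P.H w₀ : Set c.G))
  (N : ℕ → Subgroup c.G) (hNn : ∀ n, (N n).Normal)
  (hNst : ∀ (n : ℕ) (e : outerSemidirectProduct ρ) (x : c.G), x ∈ N n →
    (((contMulAut c.G).subtype.comp (MonoidHom.fst (contMulAut c.G) PA)).comp
      (outerSemidirectProduct ρ).subtype) e x ∈ N n)
  (hNanti : Antitone N) (hNopen : ∀ n, IsOpen (N n : Set c.G))
  (hNcof : ∀ U ∈ 𝓝 (1 : c.G), ∃ n, (N n : Set c.G) ⊆ U)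
  (hK1' : ∀ n, IsOpen (((P.levelKer hP (N n) (hNst n)).map (outerSemidirectProductSnd ρ) :
    Subgroup PA) : Set PA))

include h36 hA hcpt hNn hNanti hNopen hNcof hK1'

/-- **The tempered level topology is FINER than the generic outer-semidirect-product topology along the
same levels** (`≤` in the order of `TopologicalSpace`): every `levelNhd (N n) V`, `V ∈ 𝓝 1`, contains a
basic tempered neighbourhood `levelKer (N n) ⊓ aug⁻¹U`, `U ⊴ Π_A` open normal inside `V` (`Π_A` tempered).
[cite: MochizukiSemiAnbd2006, Prop 5.2 (iv), p. 64] -/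
theorem arithLevelTopology_le_topology :
    arithLevelTopology c ρ baseAct h36 hA P hP w₀ hcpt N hNn hNst hNanti hNopen hNcof hK1' ≤
      outerSemidirectProduct.topology ρ N (directed_ge_of_antitone c N hNanti)
        (hinv_of_hNst c ρ N hNst) := by
  haveI : Nonempty ℕ := ⟨0⟩
  set tB := arithLevelTopology c ρ baseAct h36 hA P hP w₀ hcpt N hNn hNst hNanti hNopen hNcof hK1' with htB
  set tA := outerSemidirectProduct.topology ρ N (directed_ge_of_antitone c N hNanti)
    (hinv_of_hNst c ρ N hNst) with htA
  have hgB : @IsTopologicalGroup _ tB _ :=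
    arithLevelTopology_isTopologicalGroup c ρ baseAct h36 hA P hP w₀ hcpt N hNn hNst hNanti hNopen hNcof hK1'
  have hgA : @IsTopologicalGroup _ tA _ :=
    outerSemidirectProduct.isTopologicalGroup ρ N _ _
  -- reduce to the neighbourhood filters of `1`
  have h1 : @nhds _ tB 1 ≤ @nhds _ tA 1 := by
    rw [(outerSemidirectProduct.hasBasis_nhds_one ρ N (directed_ge_of_antitone c N hNanti)
      (hinv_of_hNst c ρ N hNst)).ge_iff]
    rintro ⟨n, V⟩ hV
    -- an open normal subgroup of the tempered `Π_A` inside `V`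
    obtain ⟨U, -, hUV⟩ := hA.hasBasis_nhds_one.mem_iff.mp hV
    refine Filter.mem_of_superset
      ((arithLevelTopology_nhds_hasBasis c ρ baseAct h36 hA P hP w₀ hcpt N hNn hNst hNanti hNopen hNcof
        hK1').mem_of_mem (i := (n, U)) trivial) ?_
    rintro e ⟨he, heU⟩
    refine ⟨fun g => ?_, hUV heU⟩
    -- `levelKer ⊆ centralMod`: `Φ e g * g⁻¹ ∈ N n`, and `N n` is normal
    have hc := ((P.mem_levelKer_iff hP (N n) (hNst n)).mp he).2.2 g
    have : g⁻¹ * ((e.1.1 : MulAut c.G) g) = g⁻¹ * ((e.1.1 : MulAut c.G) g * g⁻¹) * g⁻¹⁻¹ := by group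
    rw [this]
    exact (hNn n).conj_mem _ hc g⁻¹
  -- translate to every point
  refine le_of_nhds_le_nhds fun x => ?_
  rw [← @map_mul_left_nhds_one _ tB _ hgB x, ← @map_mul_left_nhds_one _ tA _ hgA x]
  exact Filter.map_mono h1

/-- **Conversely**: if the kernels of the arithmetic actions on the level coset semi-graphs are open for
the generic topology (`hKopen` there) and the action of `Π_A` on the underlying semi-graph has open kernel
([SemiAnbd] Def 5.1 (i)(c)), the generic topology is finer than the tempered level topology.
[cite: MochizukiSemiAnbd2006, Prop 5.2 (iv), p. 64] -/
theorem topology_le_arithLevelTopology_of_isOpen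
    (hKopenA : ∀ n, IsOpen[outerSemidirectProduct.topology ρ N (directed_ge_of_antitone c N hNanti)
      (hinv_of_hNst c ρ N hNst)] ((P.arithAct hP (N n) (hNst n)).ker : Set (outerSemidirectProduct ρ)))
    (hbase : IsOpen (baseAct.ker : Set PA)) :
    outerSemidirectProduct.topology ρ N (directed_ge_of_antitone c N hNanti)
        (hinv_of_hNst c ρ N hNst) ≤
      arithLevelTopology c ρ baseAct h36 hA P hP w₀ hcpt N hNn hNst hNanti hNopen hNcof hK1' := by
  haveI : Nonempty ℕ := ⟨0⟩
  set tB := arithLevelTopology c ρ baseAct h36 hA P hP w₀ hcpt N hNn hNst hNanti hNopen hNcof hK1' with htB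
  set tA := outerSemidirectProduct.topology ρ N (directed_ge_of_antitone c N hNanti)
    (hinv_of_hNst c ρ N hNst) with htA
  have hgB : @IsTopologicalGroup _ tB _ :=
    arithLevelTopology_isTopologicalGroup c ρ baseAct h36 hA P hP w₀ hcpt N hNn hNst hNanti hNopen hNcof hK1'
  have hgA : @IsTopologicalGroup _ tA _ :=
    outerSemidirectProduct.isTopologicalGroup ρ N _ _
  have hcontA : @Continuous _ _ tA _ (outerSemidirectProductSnd ρ) :=
    outerSemidirectProduct.continuous_snd ρ N _ _
  have h1 : @nhds _ tA 1 ≤ @nhds _ tB 1 := by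
    rw [(arithLevelTopology_nhds_hasBasis c ρ baseAct h36 hA P hP w₀ hcpt N hNn hNst hNanti hNopen hNcof
      hK1').ge_iff]
    rintro ⟨n, U⟩ -
    -- the four ingredients of `levelKer (N n) ⊓ aug⁻¹U` are neighbourhoods of `1` for `tA`
    have hker : ((P.arithAct hP (N n) (hNst n)).ker : Set (outerSemidirectProduct ρ)) ∈ @nhds _ tA 1 :=
      @IsOpen.mem_nhds _ tA _ _ (hKopenA n) (Subgroup.one_mem _)
    have hσ : ((baseAct.comp (outerSemidirectProductSnd ρ)).ker : Set (outerSemidirectProduct ρ)) ∈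
        @nhds _ tA 1 := by
      refine @IsOpen.mem_nhds _ tA _ _ ?_ (Subgroup.one_mem _)
      have : ((baseAct.comp (outerSemidirectProductSnd ρ)).ker : Set (outerSemidirectProduct ρ)) =
          outerSemidirectProductSnd ρ ⁻¹' (baseAct.ker : Set PA) := by
        ext e; simp [MonoidHom.mem_ker]
      rw [this]
      exact @IsOpen.preimage _ _ tA _ _ hcontA _ hbase
    have hcm : ((SemiGraph.SubgroupPresentation.centralMod
        (((contMulAut c.G).subtype.comp (MonoidHom.fst (contMulAut c.G) PA)).comp
          (outerSemidirectProduct ρ).subtype) (N n) : Subgroup (outerSemidirectProduct ρ)) :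
            Set (outerSemidirectProduct ρ)) ∈ @nhds _ tA 1 := by
      refine Filter.mem_of_superset (outerSemidirectProduct.levelNhd_mem_nhds_one ρ N
        (directed_ge_of_antitone c N hNanti) (hinv_of_hNst c ρ N hNst) n Filter.univ_mem) ?_
      rintro e ⟨he, -⟩
      rw [SetLike.mem_coe, SemiGraph.SubgroupPresentation.mem_centralMod_iff]
      intro y
      have hy := he y
      have : ((e.1.1 : MulAut c.G) y) * y⁻¹ = y * (y⁻¹ * (e.1.1 : MulAut c.G) y) * y⁻¹ := by group
      change ((e.1.1 : MulAut c.G) y) * y⁻¹ ∈ N n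
      rw [this]
      exact (hNn n).conj_mem _ hy y
    have hU : ((U.toSubgroup.comap (outerSemidirectProductSnd ρ) : Subgroup (outerSemidirectProduct ρ)) :
        Set (outerSemidirectProduct ρ)) ∈ @nhds _ tA 1 := by
      refine @IsOpen.mem_nhds _ tA _ _ ?_ (Subgroup.one_mem _)
      exact @IsOpen.preimage _ _ tA _ _ hcontA _ U.isOpen
    refine Filter.mem_of_superset (Filter.inter_mem (Filter.inter_mem (Filter.inter_mem hker hσ) hcm) hU) ?_
    rintro e ⟨⟨⟨h1, h2⟩, h3⟩, h4⟩
    exact Subgroup.mem_inf.mpr ⟨(P.mem_levelKer_iff hP (N n) (hNst n)).mpr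
      ⟨MonoidHom.mem_ker.mp h1, MonoidHom.mem_ker.mp h2,
        (SemiGraph.SubgroupPresentation.mem_centralMod_iff).mp h3⟩, h4⟩
  refine le_of_nhds_le_nhds fun x => ?_
  rw [← @map_mul_left_nhds_one _ tA _ hgA x, ← @map_mul_left_nhds_one _ tB _ hgB x]
  exact Filter.map_mono h1

/-- **Equality criterion**: under `hKopen` for the generic topology and an open kernel of the base action,
the tempered level topology of abc-iut-w6-d070 and the generic topology of abc-iut-w5-d151 COINCIDE.
[cite: MochizukiSemiAnbd2006, Prop 5.2 (iv), p. 64] -/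
theorem arithLevelTopology_eq_topology_of_isOpen
    (hKopenA : ∀ n, IsOpen[outerSemidirectProduct.topology ρ N (directed_ge_of_antitone c N hNanti)
      (hinv_of_hNst c ρ N hNst)] ((P.arithAct hP (N n) (hNst n)).ker : Set (outerSemidirectProduct ρ)))
    (hbase : IsOpen (baseAct.ker : Set PA)) :
    arithLevelTopology c ρ baseAct h36 hA P hP w₀ hcpt N hNn hNst hNanti hNopen hNcof hK1' =
      outerSemidirectProduct.topology ρ N (directed_ge_of_antitone c N hNanti)
        (hinv_of_hNst c ρ N hNst) :=
  le_antisymm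
    (arithLevelTopology_le_topology c ρ baseAct h36 hA P hP w₀ hcpt N hNn hNst hNanti hNopen hNcof hK1')
    (topology_le_arithLevelTopology_of_isOpen c ρ baseAct h36 hA P hP w₀ hcpt N hNn hNst hNanti hNopen hNcof
      hK1' hKopenA hbase)

end Comparison

end ProfiniteSemiGraph

end Literature.AnabelianGeometry.SemiGraphs
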